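import Summits.ResolutionOfSingularities.ResolutionOfSingularities.Theorems.EquisingularLiftEquisingularLiftNatHilbertBurchComplex
import Mathlib
import HarnessLib

/-!
# [OURS · L1 W4.5(b)] HILBERT–BURCH, PART 2 — THE LIFT OVER A DVR: the maximal minors of a lifted `(t+1) × t` matrix
# generate a `ϖ`-torsion-free ideal with special fibre the reduced ideal of minors, as soon as the REDUCED Hilbert–Burch
# complex is exact in the middle (rung v6′ «DET-nose», ring core)
# (crux `EquisingularLiftNatThree` = stmt-ResolutionOfSingularities-20148, parent `EquisingularLiftNat` = stmt-20038,
# line `sections`, research residue `stub_elnat_three_nonisolated_nonci`)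

NOT a statement of any manuscript. Helper file of the chain res-L1-w45b (cell `res-hironaka`, rung L, slot W4.5(b));
AI-written, weaker than expert review; filed `--supports stmt-ResolutionOfSingularities-20148 --as helper`.

WHERE IT SITS (res-L1-w45b-lead-2 LEAD-MEMO-5 e186de0624463c55 §B rung v6′ «DET-nose» / §C DEALABLE (i) «maximal minors
of a lifted matrix generate an O-flat ideal when the reduction has grade 2», 2026-08-27T09:13:54Z). Setting: an
ARBITRARY commutative ring `A`, a non-zero-divisor `ϖ ∈ A` and a surjection `f : A → B` with `f ϖ = 0`, `ker f ⊆ (ϖ)`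
(think `A = O[x₀,…,xₙ]`, `O` a DVR with uniformizer `ϖ`, `B = k[x₀,…,xₙ]`, `f` = coefficientwise reduction);
`M : Matrix (Fin (t+1)) (Fin t) A`, `Δᵢ(M) = det (M.submatrix i.succAbove id)`, `I_t(M) = Ideal.span (range Δ(M))`,
functional `det [M | c] = det (Matrix.of fun i => Fin.snoc (M i) (c i))` (part 1 `…NatHilbertBurchComplex.lean`).
* `det_submatrix_map`, `map_sum_minor`, `map_det_of_snoc` — minors / the functional commute with ring maps;
  **`map_span_minor`** — `f I_t(M) · B = I_t(M.map f)`: the SPECIAL FIBRE of `A/I_t(M)` is `B/I_t(M̄)`;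
  `comap_span_minor_map`; `exists_matrix_map_eq_of_surjective` (matrices lift entrywise).
* **`mem_span_minor_of_mul_mem`** — THE LIFT: if the reduced matrix `M.map f` has Hilbert–Burch complex exact in the
  middle, then `ϖ·x ∈ I_t(M) ⇒ x ∈ I_t(M)`; `isSMulRegular_quotient_span_minor` (`ϖ` is regular on `A ⧸ I_t(M)`);
  `mem_span_minor_of_pow_mul_mem` (powers of `ϖ`).
* **`mem_span_minor_of_mul_mem_of_regular_pair`** — combined with part 1: a regular pair `a, b ∈ I_t(M.map f)` over `B`
  (grade ≥ 2 downstairs) suffices. This is the ring core of rung v6′: a lifted Hilbert–Burch matrix of an ACM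
  codimension-2 subscheme is a flat deformation of it.
The DVR / polynomial-ring packaging (`Module.Flat O`, residue models `π : O ↠ k`, homogeneous lifts) is the sequel file
`…NatHilbertBurchLiftPolynomial.lean`.

References: D. Eisenbud, *Commutative Algebra with a View Toward Algebraic Geometry* (GTM 150, 1995), §20 (Thm. 20.15
Hilbert–Burch); the proofs are elementary and do not use the source. res-L1-w45b-lead-2 LEAD-MEMO-5 (OURS planning text,
index only).
-/

set_option linter.dupNamespace false -- mandated namespace `Summit.<Summit>.<Problem>` of this single-conjunct summit

namespace Summit.ResolutionOfSingularities.ResolutionOfSingularities.Cruxes.EquisingularLiftNat.Sections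

open Matrix

universe u v

section HilbertBurchLift

variable {A : Type u} [CommRing A] {t : ℕ}

/-! ## Reduction maps: minors commute with ring homomorphisms -/

/-- Maximal minors commute with ring maps: `Δᵢ(M.map f) = f (Δᵢ M)`. [folklore] [OURS · L1 W4.5b] -/
theorem det_submatrix_map {B : Type v} [CommRing B] (f : A →+* B) (M : Matrix (Fin (t + 1)) (Fin t) A)
    (i : Fin (t + 1)) :
    ((M.map f).submatrix i.succAbove id).det = f (M.submatrix i.succAbove id).det := by
  rw [RingHom.map_det, RingHom.mapMatrix_apply, Matrix.submatrix_map]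

/-- The Hilbert–Burch functional commutes with ring maps. [folklore] [OURS · L1 W4.5b] -/
theorem map_sum_minor {B : Type v} [CommRing B] (f : A →+* B) (M : Matrix (Fin (t + 1)) (Fin t) A)
    (c : Fin (t + 1) → A) :
    f (∑ i : Fin (t + 1), (-1) ^ ((i : ℕ) + t) * c i * (M.submatrix i.succAbove id).det) =
      ∑ i : Fin (t + 1), (-1) ^ ((i : ℕ) + t) * f (c i) * ((M.map f).submatrix i.succAbove id).det := by
  rw [map_sum]
  refine Finset.sum_congr rfl fun i _ => ?_
  rw [map_mul, map_mul, map_pow, map_neg, map_one, det_submatrix_map]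

/-- The augmented determinant commutes with ring maps: `f (det [M | c]) = det [M.map f | f ∘ c]`.
[folklore] [OURS · L1 W4.5b] -/
theorem map_det_of_snoc {B : Type v} [CommRing B] (f : A →+* B) (M : Matrix (Fin (t + 1)) (Fin t) A)
    (c : Fin (t + 1) → A) :
    f (Matrix.of fun i => (Fin.snoc (M i) (c i) : Fin (t + 1) → A)).det =
      (Matrix.of fun i => (Fin.snoc ((M.map f) i) (f (c i)) : Fin (t + 1) → B)).det := by
  rw [det_of_snoc_eq_sum, det_of_snoc_eq_sum, map_sum_minor]

/-- **The ideal of maximal minors commutes with base change along a ring map**: `f I_t(M) · B = I_t(M.map f)`;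
in particular the SPECIAL FIBRE of `A/I_t(M)` along `f : A ↠ A/(ϖ) = B` is `B/I_t(M̄)`. [folklore] [OURS · L1 W4.5b] -/
theorem map_span_minor {B : Type v} [CommRing B] (f : A →+* B) (M : Matrix (Fin (t + 1)) (Fin t) A) :
    (Ideal.span (Set.range fun i : Fin (t + 1) => (M.submatrix i.succAbove id).det)).map f =
      Ideal.span (Set.range fun i : Fin (t + 1) => ((M.map f).submatrix i.succAbove id).det) := by
  rw [Ideal.map_span, ← Set.range_comp]
  have h : (⇑f ∘ fun i : Fin (t + 1) => (M.submatrix i.succAbove id).det) =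
      fun i : Fin (t + 1) => ((M.map f).submatrix i.succAbove id).det := by
    funext i
    rw [Function.comp_apply, det_submatrix_map]
  rw [h]

/-- Pull-back form: for `f` surjective, `f⁻¹ I_t(M.map f) = I_t(M) + ker f`. [folklore] [OURS · L1 W4.5b] -/
theorem comap_span_minor_map {B : Type v} [CommRing B] (f : A →+* B) (hf : Function.Surjective f)
    (M : Matrix (Fin (t + 1)) (Fin t) A) :
    (Ideal.span (Set.range fun i : Fin (t + 1) => ((M.map f).submatrix i.succAbove id).det)).comap f =
      Ideal.span (Set.range fun i : Fin (t + 1) => (M.submatrix i.succAbove id).det) ⊔ RingHom.ker f := by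
  rw [← map_span_minor, Ideal.comap_map_of_surjective f hf, RingHom.ker_eq_comap_bot]

/-- Matrices lift entrywise along a surjective ring map. [folklore] [OURS · L1 W4.5b] -/
theorem exists_matrix_map_eq_of_surjective {B : Type v} [CommRing B] (f : A →+* B) (hf : Function.Surjective f)
    {m n : Type*} (N : Matrix m n B) : ∃ M : Matrix m n A, M.map f = N := by
  choose g hg using hf
  exact ⟨fun i j => g (N i j), by ext i j; exact hg (N i j)⟩

/-! ## The lift: `ϖ`-torsion-freeness of `A ⧸ I_t(M)` from exactness of the reduced complex -/

/-- **HILBERT–BURCH LIFT (torsion-freeness).** Let `ϖ ∈ A` be a non-zero-divisor, `f : A ↠ B` a surjective ring map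
with `f ϖ = 0` and `ker f ⊆ (ϖ)`, and `M : A^{(t+1) × t}`. If the REDUCED Hilbert–Burch complex is exact in the
middle (`det [M̄ | c̄] = 0 ⇒ c̄ ∈ im M̄`, `M̄ = M.map f`), then `ϖ x ∈ I_t(M) ⇒ x ∈ I_t(M)`: the uniformizer is a
non-zero-divisor on `A / I_t(M)`. (No hypothesis on `M` upstairs beyond being a lift.) [folklore: flatness of lifted
determinantal ideals, cf. Eisenbud GTM 150 §20; elementary proof OURS] [OURS · L1 W4.5b] -/
theorem mem_span_minor_of_mul_mem {B : Type v} [CommRing B] (f : A →+* B) (hf : Function.Surjective f)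
    {ϖ : A} (hϖ : ϖ ∈ nonZeroDivisors A) (hfϖ : f ϖ = 0) (hker : ∀ x : A, f x = 0 → x ∈ Ideal.span {ϖ})
    (M : Matrix (Fin (t + 1)) (Fin t) A)
    (hex : ∀ c : Fin (t + 1) → B,
      (Matrix.of fun i => (Fin.snoc ((M.map f) i) (c i) : Fin (t + 1) → B)).det = 0 →
        ∃ w : Fin t → B, (M.map f) *ᵥ w = c)
    {x : A} (hx : ϖ * x ∈ Ideal.span (Set.range fun i : Fin (t + 1) => (M.submatrix i.succAbove id).det)) :
    x ∈ Ideal.span (Set.range fun i : Fin (t + 1) => (M.submatrix i.succAbove id).det) := by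
  -- `ϖ x = Δ(c)`
  obtain ⟨c, hc⟩ := exists_sum_minor_eq_of_mem_span M hx
  -- reduce: `Δ̄ (f ∘ c) = f (ϖ x) = 0`
  have h1 : (Matrix.of fun i => (Fin.snoc ((M.map f) i) (f (c i)) : Fin (t + 1) → B)).det = 0 := by
    rw [← map_det_of_snoc, det_of_snoc_eq_sum, hc, map_mul, hfϖ, zero_mul]
  obtain ⟨wbar, hwbar⟩ := hex (fun i => f (c i)) h1
  -- lift `w̄`
  choose g hg using hf
  have h2 : ∀ i : Fin (t + 1), ∃ c' : A, c' * ϖ = c i - (M *ᵥ fun j => g (wbar j)) i := by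
    intro i
    refine Ideal.mem_span_singleton'.mp (hker _ ?_)
    rw [map_sub, RingHom.map_mulVec]
    have h3 : (f ∘ fun j => g (wbar j)) = wbar := by
      funext j; simp only [Function.comp_apply, hg]
    rw [h3, hwbar, sub_self]
  choose c' hc' using h2
  -- `c = M w + ϖ • c'`
  have h4 : c = (M *ᵥ fun j => g (wbar j)) + ϖ • c' := by
    funext i
    simp only [Pi.add_apply, Pi.smul_apply, smul_eq_mul]
    rw [mul_comm, hc' i, add_sub_cancel]
  -- apply the functional
  have h5 : ϖ * x = ϖ * ∑ i : Fin (t + 1), (-1) ^ ((i : ℕ) + t) * c' i * (M.submatrix i.succAbove id).det := by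
    rw [← hc, h4, sum_minor_add, sum_minor_mulVec_eq_zero, zero_add, sum_minor_smul]
  have h6 : x = ∑ i : Fin (t + 1), (-1) ^ ((i : ℕ) + t) * c' i * (M.submatrix i.succAbove id).det := by
    have h7 : ϖ * (x - ∑ i : Fin (t + 1), (-1) ^ ((i : ℕ) + t) * c' i * (M.submatrix i.succAbove id).det) = 0 := by
      rw [mul_sub, h5, sub_self]
    exact sub_eq_zero.mp ((mem_nonZeroDivisors_iff.mp hϖ).1 _ h7)
  rw [h6]
  exact sum_minor_mem_span M c'

/-- **HILBERT–BURCH LIFT, `IsSMulRegular` form**: under the hypotheses of `mem_span_minor_of_mul_mem`, `ϖ` is a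
non-zero-divisor on the `A`-module `A ⧸ I_t(M)`. [folklore] [OURS · L1 W4.5b] -/
theorem isSMulRegular_quotient_span_minor {B : Type v} [CommRing B] (f : A →+* B) (hf : Function.Surjective f)
    {ϖ : A} (hϖ : ϖ ∈ nonZeroDivisors A) (hfϖ : f ϖ = 0) (hker : ∀ x : A, f x = 0 → x ∈ Ideal.span {ϖ})
    (M : Matrix (Fin (t + 1)) (Fin t) A)
    (hex : ∀ c : Fin (t + 1) → B,
      (Matrix.of fun i => (Fin.snoc ((M.map f) i) (c i) : Fin (t + 1) → B)).det = 0 →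
        ∃ w : Fin t → B, (M.map f) *ᵥ w = c) :
    IsSMulRegular (A ⧸ Ideal.span (Set.range fun i : Fin (t + 1) => (M.submatrix i.succAbove id).det)) ϖ := by
  intro p q hpq
  obtain ⟨x, rfl⟩ := Ideal.Quotient.mk_surjective p
  obtain ⟨y, rfl⟩ := Ideal.Quotient.mk_surjective q
  have h1 : Ideal.Quotient.mk _ (ϖ * x) = Ideal.Quotient.mk
      (Ideal.span (Set.range fun i : Fin (t + 1) => (M.submatrix i.succAbove id).det)) (ϖ * y) := by
    simp only at hpq
    rw [map_mul, map_mul, ← Ideal.Quotient.algebraMap_eq, ← Algebra.smul_def, ← Algebra.smul_def]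
    exact hpq
  rw [Ideal.Quotient.eq] at h1 ⊢
  rw [← mul_sub] at h1
  exact mem_span_minor_of_mul_mem f hf hϖ hfϖ hker M hex h1

/-- **Powers**: under the same hypotheses `ϖⁿ x ∈ I_t(M) ⇒ x ∈ I_t(M)`. [folklore] [OURS · L1 W4.5b] -/
theorem mem_span_minor_of_pow_mul_mem {B : Type v} [CommRing B] (f : A →+* B) (hf : Function.Surjective f)
    {ϖ : A} (hϖ : ϖ ∈ nonZeroDivisors A) (hfϖ : f ϖ = 0) (hker : ∀ x : A, f x = 0 → x ∈ Ideal.span {ϖ})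
    (M : Matrix (Fin (t + 1)) (Fin t) A)
    (hex : ∀ c : Fin (t + 1) → B,
      (Matrix.of fun i => (Fin.snoc ((M.map f) i) (c i) : Fin (t + 1) → B)).det = 0 →
        ∃ w : Fin t → B, (M.map f) *ᵥ w = c)
    (n : ℕ) {x : A}
    (hx : ϖ ^ n * x ∈ Ideal.span (Set.range fun i : Fin (t + 1) => (M.submatrix i.succAbove id).det)) :
    x ∈ Ideal.span (Set.range fun i : Fin (t + 1) => (M.submatrix i.succAbove id).det) := by
  induction n generalizing x with
  | zero => simpa using hx
  | succ n ih =>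
    apply ih
    apply mem_span_minor_of_mul_mem f hf hϖ hfϖ hker M hex
    rw [← mul_assoc, mul_comm ϖ, ← pow_succ]
    exact hx

/-- **HILBERT–BURCH LIFT from grade-two data downstairs.** `ϖ ∈ A` a non-zero-divisor, `f : A ↠ B` with `f ϖ = 0`,
`ker f ⊆ (ϖ)`; `M : A^{(t+1) × t}` with reduction `M̄ = M.map f`. If `I_t(M̄)` contains `a, b` with `a` a
non-zero-divisor of `B` and `b` a non-zero-divisor of `B/(a)`, then `ϖ x ∈ I_t(M) ⇒ x ∈ I_t(M)` — `A/I_t(M)` is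
`ϖ`-torsion-free, with special fibre `B/I_t(M̄)` (`map_span_minor`). This is the ring core of rung v6′ «DET-nose»:
a lifted Hilbert–Burch matrix of an ACM codimension-2 subscheme is a flat deformation of it.
[Eisenbud GTM 150 Thm. 20.15 + §20; elementary proof OURS] [OURS · L1 W4.5b] -/
theorem mem_span_minor_of_mul_mem_of_regular_pair {B : Type v} [CommRing B] (f : A →+* B)
    (hf : Function.Surjective f) {ϖ : A} (hϖ : ϖ ∈ nonZeroDivisors A) (hfϖ : f ϖ = 0)
    (hker : ∀ x : A, f x = 0 → x ∈ Ideal.span {ϖ}) (M : Matrix (Fin (t + 1)) (Fin t) A) {a b : B}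
    (haI : a ∈ Ideal.span (Set.range fun i : Fin (t + 1) => ((M.map f).submatrix i.succAbove id).det))
    (hbI : b ∈ Ideal.span (Set.range fun i : Fin (t + 1) => ((M.map f).submatrix i.succAbove id).det))
    (ha : a ∈ nonZeroDivisors B) (hb : ∀ y : B, b * y ∈ Ideal.span {a} → y ∈ Ideal.span {a}) {x : A}
    (hx : ϖ * x ∈ Ideal.span (Set.range fun i : Fin (t + 1) => (M.submatrix i.succAbove id).det)) :
    x ∈ Ideal.span (Set.range fun i : Fin (t + 1) => (M.submatrix i.succAbove id).det) :=
  mem_span_minor_of_mul_mem f hf hϖ hfϖ hker M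
    (fun c hc => exists_mulVec_eq_of_det_snoc_eq_zero (M.map f) haI hbI ha hb c hc) hx

end HilbertBurchLift

end Summit.ResolutionOfSingularities.ResolutionOfSingularities.Cruxes.EquisingularLiftNat.Sections
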